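import Summits.BirchSwinnertonDyer.BirchSwinnertonDyer.Theorems.KolyvaginRankRigidityAtTwoRegularRefillAtRegularStep
import Summits.BirchSwinnertonDyer.BirchSwinnertonDyer.Theorems.KolyvaginRankRigidityAtTwoWalkStepRefill
import Summits.BirchSwinnertonDyer.BirchSwinnertonDyer.Theorems.KolyvaginRankRigidityAtTwoRegularRefillSign
import Summits.BirchSwinnertonDyer.BirchSwinnertonDyer.Theorems.KolyvaginRankRigidityAtTwoInvWeilPairingConj
import Summits.BirchSwinnertonDyer.BirchSwinnertonDyer.Theorems.Rank1ResidualJetRowDualityPrep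
import Summits.BirchSwinnertonDyer.BirchSwinnertonDyer.Theorems.Rank1ResidualJetConjActSelmer
import Summits.BirchSwinnertonDyer.BirchSwinnertonDyer.Theorems.Rank1ResidualJetSignedGlobalDualityPlus
import Summits.BirchSwinnertonDyer.Rank1Residual.JET.TransverseFamilyConjAct
import HarnessLib

/-!
# Crux U1 `KolyvaginBoundedDefectAtTwo` (stmt-BirchSwinnertonDyer-28083), LINE 17 `regular_core_rigidity` v3,
# stub S1b `stub_nearCoreExistenceAtTwo` — ONE STEP OF THE WALK, LOCAL CONSEQUENCES III: the SIGN of the refill and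
# the new eigenclass of the opposite sign

Width seat `bsd-line-krr2-p2` g14 (ONE READER on S1b); `--supports stmt-BirchSwinnertonDyer-28083` (helper). THEOREMS
ONLY; nothing here proves S1b, U1, a rung or BSD. BSD is NOT proved.

## Setting (g13's, `…RegularRefillAtRegularStep`)
`𝓛 = 𝓕(c)`, a regular place `v ∣ ℓ ∣ c` fixed by `τ` (`hfix`), `τ_* = conjActPlace W τ 2^k hfix` on `H¹(K_v, E[2^k])`,
`S = H¹_{𝓛[v ↦ Kum_v]}` ∋ an `s`-eigenclass `z` with `addOrderOf (loc_v z) = 2^(k−j)`, `S' = H¹_{𝓛}`.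
Extra frame data: the Weil datum is `τ`-equivariant at `v` (`hτe`, an instance of the tree's
`exists_weilPairing_liftEquivariant`) and the local invariants are `τ`-compatible (`hinvc`).
* `conjAct_mem_selmerGroup_selmerF` — `H¹_{𝓕(c)}` is `τ_*`-stable (JET transport lemmas);
* **`nsmul_conjActPlace_add_smul_localization_eq_zero`** — THE SIGN: for every `t ∈ S'`,
  `2^j • (τ_*(loc_v t) + s • loc_v t) = 0` (abstract sign lemma `nsmul_add_smul_eq_zero_of_mem_lagrangian`, p684722, for
  `b_v = inv_v(· ∪ₑ ·)`, `τ_*`-invariant by `invWeilPairing_conjActPlace`, p684992; the cut `2^j Kum_v^{(s)} ⊆ ℤ(loc_v z) ⊆ X`):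
  the refill at `v` is a `(−s)`-eigenvector up to `2^j`-torsion;
* **`oppositeSign_class`** — for `r ∈ S'`, `q = τ_* r − s•r ∈ S'` has `τ_* q = (−s)•q`, and under the SIGN
  `addOrderOf (loc_v r) ≤ 2^(j+1) · addOrderOf (loc_v q)`: the walk's NEW FRAME CLASS of the opposite sign (with
  `exists_refill_class` of `…WalkStepRefillClass`, `r` of local order `≥ #loc_v(S')/(2·4^j)`).
References (locators only; no cited FACT is declared): [cite: MazurRubin2004, Prop. 1.3.2, §4.1, proof of Prop. 4.1.5]
[cite: GrossLMS1991, §3 (3.3), §5 (5.1)] [cite: Jetchev2008, §4.3, Lemma 5.2 (iii)].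
Design: no definitions; `K : Type`; axioms `propext`, `Classical.choice`, `Quot.sound`.
-/

set_option autoImplicit false
-- the Theorems namespace of this sub repeats the summit name by design (D-0017 nested layout)
set_option linter.dupNamespace false

noncomputable section

open scoped Classical
open Function NumberField IsDedekindDomain WeierstrassCurve Field
open Literature.NumberTheory.EllipticCurves Literature.NumberTheory.EllipticCurves.Jetchev2008
open Literature.NumberTheory.GaloisRepresentations Literature.NumberTheory.GaloisCohomology
open Literature.NumberTheory.GaloisRepresentations.DiscreteGaloisModule (localTatePairingZMod tateDual
  transverseSubgroup SelmerStructure)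
open Literature.NumberTheory.Automorphic
open Summit.BirchSwinnertonDyer.Rank1Residual
open Summit.BirchSwinnertonDyer.Rank1Residual.JET.RingClassTransverse
open Summit.BirchSwinnertonDyer.Rank1Residual.JET.SelmerVocabulary
open Summit.BirchSwinnertonDyer.Rank1Residual.X11b.Relaxation (invWeilPairing invWeilPairing_apply
  invWeilPairing_eq_zero_of_mem)
open Summit.BirchSwinnertonDyer.BirchSwinnertonDyer.Theorems.KolyvaginLowerBoundAtTwo
open Summit.BirchSwinnertonDyer.Rank1Residual.JET.Section6 (card_eq_card_inf_ker_mul_card_map card_map_mul_card_map_le)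

namespace Summit.BirchSwinnertonDyer.BirchSwinnertonDyer.Theorems.KolyvaginAtTwo.RegularRefill

variable {K : Type} [Field K] [NumberField K] (W : WeierstrassCurve ℚ) [W.IsElliptic] [W.IsGloballyMinimal]
  (k : ℕ)
  (e : geomTorsion (W.baseChange K) ((2 ^ k : ℕ) : ℤ) → geomTorsion (W.baseChange K) ((2 ^ k : ℕ) : ℤ) →
    AlgebraicClosure K)
  (hμ : ∀ S T, e S T ^ (2 ^ k) = 1)
  (hadd₁ : ∀ S₁ S₂ T, e (S₁ + S₂) T = e S₁ T * e S₂ T)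
  (hadd₂ : ∀ S T₁ T₂, e S (T₁ + T₂) = e S T₁ * e S T₂)
  (hgal : ∀ (g : absoluteGaloisGroup K) (S T : geomTorsion (W.baseChange K) ((2 ^ k : ℕ) : ℤ)),
    g • e S T = e (g • S) (g • T))
  (halt : ∀ T, e T T = 1) (hnondeg : ∀ T, (∀ S, e S T = 1) → T = 0)
  (inv : LocalInvariants K (2 ^ k))
  (hK : IsImaginaryQuadratic K) (hD : NumberField.discr K < -4) (ι : K →+* ℂ)
  [∀ j : ℕ, NumberField (ringClassField K ι j)] (hk : 1 ≤ k)
  (c : ℕ) (hc : Squarefree c)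
  (hkol : ∀ ℓ ∈ c.primeFactors, Zhang2014.IsKolyvaginPrime (W.conductorNorm ℤ) W K 2 ℓ)
  (hkM : ∀ ℓ ∈ c.primeFactors, k + 1 ≤ Zhang2014.kolyvaginIndex W 2 ℓ)
  (𝒯 : SelmerStructure ((W.baseChange K).torsionGaloisModule ((2 ^ k : ℕ) : ℤ)))
  (h𝒯 : ∀ v : HeightOneSpectrum (𝓞 K), 𝒯 (Sum.inr v) =
    ⨅ ℓ ∈ c.primeFactors.filter (fun ℓ : ℕ ↦ ((ℓ : ℕ) : 𝓞 K) ∈ v.asIdeal),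
      ⨅ (w' : HeightOneSpectrum (𝓞 (ringClassField K ι ℓ))) (_ : w'.asIdeal.LiesOver v.asIdeal),
        letI := (adicCompletionOfLiesOver K (ringClassField K ι ℓ) v w').toAlgebra
        transverseSubgroup (GaloisRep.toLocal v ((W.baseChange K).torsionGaloisModule ((2 ^ k : ℕ) : ℤ)))
          (w'.adicCompletion (ringClassField K ι ℓ)))
  (hperf : inv.IsPerfect) (hvan : inv.SumLocalTermEqZero) (hcomp : inv.SelmerComplement)
  {ℓ : ℕ} (hℓc : ℓ ∈ c.primeFactors)
  (hreg : ∃ (v₁ : HeightOneSpectrum (𝓞 ℚ)) (𝔓₁ : Ideal (absIntegers (𝓞 ℚ) ℚ)) (h : absoluteGaloisGroup ℚ),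
    (ℓ : 𝓞 ℚ) ∈ v₁.asIdeal ∧ 𝔓₁ ∈ v₁.primesAbove ∧ IsArithFrobAt (𝓞 ℚ) h 𝔓₁ ∧
    (∀ X : geomTorsion W ((2 ^ k : ℕ) : ℤ), h • h • X = X) ∧
    ∃ P : geomTorsion W ((2 ^ k : ℕ) : ℤ), (2 : ℤ) ^ (k - 1) • (P + h • P) ≠ 0)
  (v : HeightOneSpectrum (𝓞 K)) (hv : (ℓ : 𝓞 K) ∈ v.asIdeal)
  {τ : K ≃ₐ[ℚ] K} (hτ1 : τ ≠ 1) (hfix : τ • v = v) {s : ℤ} (hs : s = 1 ∨ s = -1)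
  (hτe : ∀ S T, liftAutPlace τ hfix (e S T) =
    e ((isLiftOfAut_liftAutPlace τ hfix).torsionMap W (2 ^ k) S) ((isLiftOfAut_liftAutPlace τ hfix).torsionMap W (2 ^ k) T))
  (hinvc : inv.IsConjCompatible τ)

/-! ### In situ: `τ`-stability, the sign, the opposite-sign class -/

include hK hc h𝒯 in
omit [W.IsElliptic] [W.IsGloballyMinimal] in
/-- **`H¹_{𝓕(c)}(K, E[2^k])` is `τ_*`-stable** (`𝒯` is `τ`-stable at the places dividing `c` by its defining formula,
JET `forall_conjActPlace_mem_of_eq_iInf_transverseSubgroup`; Kummer conditions are permuted; complex places carry no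
condition). [cite: Jetchev2008, §4.3] [cite: GrossLMS1991, §5 (5.1)] -/
theorem conjAct_mem_selmerGroup_selmerF {x : galoisCohomology ((W.baseChange K).torsionGaloisModule ((2 ^ k : ℕ) : ℤ)) 1}
    (hx : x ∈ (selmerF W ((2 ^ k : ℕ) : ℤ) 𝒯 (placesDividing K c)).selmerGroup) (τ' : K ≃ₐ[ℚ] K) :
    conjAct W τ' ((2 ^ k : ℕ) : ℤ) x ∈ (selmerF W ((2 ^ k : ℕ) : ℤ) 𝒯 (placesDividing K c)).selmerGroup :=
  JET.GlobalDuality.conjAct_mem_selmerGroup_of_transport W τ' ((2 ^ k : ℕ) : ℤ) _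
    (fun v' w h y hy ↦ JET.GlobalDuality.conjActPlace_mem_selmerF W τ' ((2 ^ k : ℕ) : ℤ) 𝒯 hc.ne_zero
      (fun v'' w' h' hv'' y' hy' ↦ JET.forall_conjActPlace_mem_of_eq_iInf_transverseSubgroup W hK ι τ'
        ((2 ^ k : ℕ) : ℤ) c 𝒯 h𝒯 v'' w' h' hv'' y' hy') v' w h y hy)
    (fun w ↦ JET.GlobalDuality.addSubgroup_galoisCohomology_inl_eq_top_of_isComplex _ (hK.2.isComplex w) _) hx

include hμ hadd₁ hadd₂ hgal hK hD hk hc hkol hkM h𝒯 halt hnondeg hperf hvan hℓc hreg hv hτ1 hs hτe hinvc in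
/-- **THE SIGN OF THE REFILL.** With an `s`-eigenclass `z ∈ S = H¹_{𝓛[v ↦ Kum_v]}` of local order `2^(k−j)` at the
regular place `v`: every `t` of the new vertex `S' = H¹_{𝓛}` satisfies `2^j • (τ_*(loc_v t) + s • loc_v t) = 0` — its
image at `v` is a `(−s)`-eigenvector up to `2^j`-torsion. The abstract sign lemma (p684722) for
`b_v = inv_v(· ∪ₑ ·)` (symmetric; `τ_*`-invariant by `invWeilPairing_conjActPlace`, p684992), the Lagrangian pair
`Kum_v ⊕ 𝒯_v`, the involution `τ_*` preserving both, the isotropic `X = loc_v(H¹_{𝓛[v ↦ ⊤]}) ∋ loc_v t`, and the cut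
`2^j · Kum_v^{(s)} ⊆ ℤ(loc_v z) ⊆ X`. [cite: MazurRubin2004, Prop. 1.3.2, §4.1] [cite: GrossLMS1991, §3 (3.3)] -/
theorem nsmul_conjActPlace_add_smul_localization_eq_zero [NeZero (2 ^ k)]
    [Finite (geomTorsion (W.baseChange K) ((2 ^ k : ℕ) : ℤ))] {j : ℕ} (hjk : j ≤ k)
    {z : galoisCohomology ((W.baseChange K).torsionGaloisModule ((2 ^ k : ℕ) : ℤ)) 1}
    (hz : z ∈ SelmerStructure.selmerGroup (Function.update (selmerF W ((2 ^ k : ℕ) : ℤ) 𝒯 (placesDividing K c))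
      (Sum.inr v : Place K) ((W.baseChange K).kummerSelmerStructure ((2 ^ k : ℕ) : ℤ) (Sum.inr v : Place K)) :
      SelmerStructure ((W.baseChange K).torsionGaloisModule ((2 ^ k : ℕ) : ℤ))))
    (hzτ : conjAct W τ ((2 ^ k : ℕ) : ℤ) z = s • z)
    (hzord : addOrderOf (galoisCohomology.localization ((W.baseChange K).torsionGaloisModule ((2 ^ k : ℕ) : ℤ))
      (Sum.inr v : Place K) 1 z) = 2 ^ (k - j))
    {t : galoisCohomology ((W.baseChange K).torsionGaloisModule ((2 ^ k : ℕ) : ℤ)) 1}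
    (ht : t ∈ (selmerF W ((2 ^ k : ℕ) : ℤ) 𝒯 (placesDividing K c)).selmerGroup) :
    (2 ^ j) • (conjActPlace W τ ((2 ^ k : ℕ) : ℤ) hfix
        (galoisCohomology.localization ((W.baseChange K).torsionGaloisModule ((2 ^ k : ℕ) : ℤ)) (Sum.inr v : Place K) 1 t) +
      s • galoisCohomology.localization ((W.baseChange K).torsionGaloisModule ((2 ^ k : ℕ) : ℤ))
        (Sum.inr v : Place K) 1 t) = 0 := by
  haveI : Finite (galoisCohomology ((((W.baseChange K).torsionGaloisModule ((2 ^ k : ℕ) : ℤ))).toLocal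
      (Sum.inr v : Place K)) 1) := finite_galoisCohomology_one_toLocal _ v
  haveI : ∀ w : Place K, CompactSpace (absoluteGaloisGroup (Place.Completion w)) :=
    fun w ↦ absoluteGaloisGroup_compactSpace _
  have hinv : Injective (inv (Sum.inr v)) := (hperf v).1.1
  have hvc : v ∈ placesDividing K c := mem_placesDividing_of_mem_primeFactors hc hℓc v hv
  have hℓ := hkol ℓ hℓc
  have hkℓ : k ≤ Zhang2014.kolyvaginIndex W 2 ℓ := Nat.le_of_succ_le (hkM ℓ hℓc)
  have hττ : τ * τ = 1 := by
    haveI : Algebra.IsQuadraticExtension ℚ K := ⟨hK.1⟩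
    have hcard : Nat.card (K ≃ₐ[ℚ] K) = 2 := by rw [IsGalois.card_aut_eq_finrank, hK.1]
    haveI : Finite (K ≃ₐ[ℚ] K) := Nat.finite_of_card_ne_zero (by rw [hcard]; decide)
    have h : τ ^ Nat.card (K ≃ₐ[ℚ] K) = 1 := pow_card_eq_one'
    rw [hcard, pow_two] at h
    exact h
  obtain ⟨⟨cs, -, hcsord, hline⟩, -⟩ := kummer_regular_eigen_at_two W K hK hk hℓ hkℓ hreg v hv hτ1 hfix hs
  set 𝓛 := selmerF W ((2 ^ k : ℕ) : ℤ) 𝒯 (placesDividing K c) with h𝓛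
  set loc := galoisCohomology.localization ((W.baseChange K).torsionGaloisModule ((2 ^ k : ℕ) : ℤ))
    (Sum.inr v : Place K) 1 with hloc
  set Rel := SelmerStructure.selmerGroup (Function.update 𝓛 (Sum.inr v : Place K) ⊤ :
    SelmerStructure ((W.baseChange K).torsionGaloisModule ((2 ^ k : ℕ) : ℤ))) with hRel
  -- `loc z ∈ X ∩ ℤc_s`, `2^j c_s ∈ ℤ(loc z)`
  have hz' := hz
  rw [selmerGroup_update_eq_inf_comap W k _ v] at hz'
  obtain ⟨hzRel, hzKum⟩ := AddSubgroup.mem_inf.mp hz'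
  have hzKum' : loc z ∈ (W.baseChange K).kummerSelmerStructure ((2 ^ k : ℕ) : ℤ) (Sum.inr v : Place K) :=
    AddSubgroup.mem_comap.mp hzKum
  have hzeig : loc z ∈ (W.baseChange K).kummerSelmerStructure ((2 ^ k : ℕ) : ℤ) (Sum.inr v) ⊓
      (conjActPlace W τ ((2 ^ k : ℕ) : ℤ) hfix - s • AddMonoidHom.id _).ker := by
    refine AddSubgroup.mem_inf.mpr ⟨hzKum', (AddMonoidHom.mem_ker).mpr ?_⟩
    rw [AddMonoidHom.sub_apply, AddMonoidHom.smul_apply, AddMonoidHom.id_apply, sub_eq_zero, hloc,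
      conjActPlace_localization, hzτ, map_zsmul]
  have hgen : (2 ^ j) • cs ∈ AddSubgroup.zmultiples (loc z) :=
    two_pow_nsmul_mem_zmultiples_of_addOrderOf hcsord ((hline _).mp hzeig) hjk hzord
  have hzX : loc z ∈ Rel.map loc := AddSubgroup.mem_map.mpr ⟨z, hzRel, rfl⟩
  -- `S' = Rel ⊓ loc⁻¹ 𝒯_v`
  have h𝓛v : 𝓛 (Sum.inr v) = 𝒯 (Sum.inr v) := by rw [h𝓛, selmerF_inr, if_pos hvc]
  have hS' : 𝓛.selmerGroup = Rel ⊓ (𝒯 (Sum.inr v)).comap loc := by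
    have h := selmerGroup_update_eq_inf_comap W k 𝓛 v (𝒯 (Sum.inr v))
    have hupd : Function.update 𝓛 (Sum.inr v : Place K) (𝒯 (Sum.inr v)) = 𝓛 := by
      rw [← h𝓛v, Function.update_eq_self]
    rw [hupd] at h
    exact h
  have ht' : loc t ∈ Rel.map loc ⊓ 𝒯 (Sum.inr v) := by
    rw [hS'] at ht
    exact AddSubgroup.mem_inf.mpr ⟨AddSubgroup.mem_map.mpr ⟨t, (AddSubgroup.mem_inf.mp ht).1, rfl⟩,
      AddSubgroup.mem_comap.mp (AddSubgroup.mem_inf.mp ht).2⟩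
  exact nsmul_add_smul_eq_zero_of_mem_lagrangian
    (invWeilPairing (W.baseChange K) (2 ^ k) e hμ hadd₁ hadd₂ hgal inv (Sum.inr v))
    (fun x y ↦ AdditiveKoly.LagrangianSwitchAtP.invWeilPairing_symm (W.baseChange K) (2 ^ k) e hμ hadd₁ hadd₂ hgal
      halt inv (Sum.inr v) x y)
    (kummer_sup_transverse_eq_top_two W k hK hD ι hk c hc hkol hkM 𝒯 h𝒯 v hvc)
    (fun x hx y hy ↦ transverse_isotropic_two W k e hμ hadd₁ hadd₂ hgal halt hnondeg inv hK hD ι hk c hc hkol hkM 𝒯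
      h𝒯 hperf v hvc hx hy)
    (conjActPlace W τ ((2 ^ k : ℕ) : ℤ) hfix)
    (fun x ↦ conjActPlace_conjActPlace W τ ((2 ^ k : ℕ) : ℤ) hττ hfix hfix x)
    (fun x y ↦ invWeilPairing_conjActPlace W τ (2 ^ k) e hμ hadd₁ hadd₂ hgal inv hinvc hfix hτe x y)
    (fun f hf ↦ conjActPlace_mem_kummerSelmerStructure W τ ((2 ^ k : ℕ) : ℤ) hfix hf)
    (fun x hx ↦ JET.forall_conjActPlace_mem_of_eq_iInf_transverseSubgroup W hK ι τ ((2 ^ k : ℕ) : ℤ) c 𝒯 h𝒯 v v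
      hfix hvc x hx)
    hs (invWeilPairing_injective_of_symm W k e hμ hadd₁ hadd₂ hgal halt hnondeg inv v hinv) (Rel.map loc)
    (isotropic_map_localization_relaxed_selmerF W k e hμ hadd₁ hadd₂ hgal halt hnondeg inv hK hD ι hk c hc hkol hkM 𝒯
      h𝒯 hperf hvan v hvc)
    j (fun f hf hfe ↦ by
      have hfl : f ∈ AddSubgroup.zmultiples cs := (hline f).mp (AddSubgroup.mem_inf.mpr ⟨hf,
        (AddMonoidHom.mem_ker).mpr (by
          rw [AddMonoidHom.sub_apply, AddMonoidHom.smul_apply, AddMonoidHom.id_apply, hfe, sub_self])⟩)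
      obtain ⟨u, rfl⟩ := AddSubgroup.mem_zmultiples_iff.mp hfl
      rw [smul_comm]
      exact AddSubgroup.zsmul_mem _ ((AddSubgroup.zmultiples_le.mpr hzX) hgen) u)
    ht'

include hK hc h𝒯 hs in
omit [W.IsElliptic] [W.IsGloballyMinimal] in
/-- **THE OPPOSITE-SIGN CLASS.** For `r ∈ S' = H¹_{𝓛}` put `q = τ_* r − s • r`. Then `q ∈ S'` and `τ_* q = (−s) • q`
(`τ_*² = 1`, `s² = 1`); and if `2^j • (τ_*(loc_v r) + s • loc_v r) = 0` (the SIGN) then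
`addOrderOf (loc_v r) ≤ 2^(j+1) · addOrderOf (loc_v q)` (`2^j • loc_v q = −s • 2^(j+1) • loc_v r`). In the walk this
is the new frame class replacing the cutter `z`. [cite: MazurRubin2004, §4.1, proof of Prop. 4.1.5]
[cite: GrossLMS1991, §5 (5.1)] -/
theorem oppositeSign_class [NeZero (2 ^ k)] [Finite (geomTorsion (W.baseChange K) ((2 ^ k : ℕ) : ℤ))]
    {r : galH1Torsion (W.baseChange K) ((2 ^ k : ℕ) : ℤ)}
    (hr : r ∈ (selmerF W ((2 ^ k : ℕ) : ℤ) 𝒯 (placesDividing K c)).selmerGroup) {j : ℕ}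
    (hsign : (2 ^ j) • (conjActPlace W τ ((2 ^ k : ℕ) : ℤ) hfix
        (galoisCohomology.localization ((W.baseChange K).torsionGaloisModule ((2 ^ k : ℕ) : ℤ)) (Sum.inr v : Place K) 1 r) +
      s • galoisCohomology.localization ((W.baseChange K).torsionGaloisModule ((2 ^ k : ℕ) : ℤ))
        (Sum.inr v : Place K) 1 r) = 0) :
    conjAct W τ ((2 ^ k : ℕ) : ℤ) r - s • r ∈ (selmerF W ((2 ^ k : ℕ) : ℤ) 𝒯 (placesDividing K c)).selmerGroup ∧
      conjAct W τ ((2 ^ k : ℕ) : ℤ) (conjAct W τ ((2 ^ k : ℕ) : ℤ) r - s • r) =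
        (-s) • (conjAct W τ ((2 ^ k : ℕ) : ℤ) r - s • r) ∧
      addOrderOf (galoisCohomology.localization ((W.baseChange K).torsionGaloisModule ((2 ^ k : ℕ) : ℤ))
          (Sum.inr v : Place K) 1 r) ≤
        2 ^ (j + 1) * addOrderOf (galoisCohomology.localization ((W.baseChange K).torsionGaloisModule
          ((2 ^ k : ℕ) : ℤ)) (Sum.inr v : Place K) 1 (conjAct W τ ((2 ^ k : ℕ) : ℤ) r - s • r)) := by
  haveI : Finite (galoisCohomology ((((W.baseChange K).torsionGaloisModule ((2 ^ k : ℕ) : ℤ))).toLocal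
      (Sum.inr v : Place K)) 1) := finite_galoisCohomology_one_toLocal _ v
  have hττ : τ * τ = 1 := by
    haveI : Algebra.IsQuadraticExtension ℚ K := ⟨hK.1⟩
    have hcard : Nat.card (K ≃ₐ[ℚ] K) = 2 := by rw [IsGalois.card_aut_eq_finrank, hK.1]
    haveI : Finite (K ≃ₐ[ℚ] K) := Nat.finite_of_card_ne_zero (by rw [hcard]; decide)
    have h : τ ^ Nat.card (K ≃ₐ[ℚ] K) = 1 := pow_card_eq_one'
    rw [hcard, pow_two] at h
    exact h
  refine ⟨AddSubgroup.sub_mem _ (conjAct_mem_selmerGroup_selmerF W k hK ι c hc 𝒯 h𝒯 hr τ)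
    (AddSubgroup.zsmul_mem _ hr s), ?_, ?_⟩
  · rw [map_sub, map_zsmul, conjAct_conjAct_of_mul_self W hττ]
    rcases hs with rfl | rfl
    · simp only [one_zsmul, neg_one_zsmul, neg_sub]
    · simp only [neg_one_zsmul, neg_neg, one_zsmul, sub_neg_eq_add]
      exact add_comm _ _
  · -- atoms: `u = loc_v r`, `w = loc_v q`
    set u := galoisCohomology.localization ((W.baseChange K).torsionGaloisModule ((2 ^ k : ℕ) : ℤ))
      (Sum.inr v : Place K) 1 r with hu
    set w := galoisCohomology.localization ((W.baseChange K).torsionGaloisModule ((2 ^ k : ℕ) : ℤ))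
      (Sum.inr v : Place K) 1 (conjAct W τ ((2 ^ k : ℕ) : ℤ) r - s • r) with hw
    have e1 : w = galoisCohomology.localization ((W.baseChange K).torsionGaloisModule ((2 ^ k : ℕ) : ℤ))
        (Sum.inr v : Place K) 1 (conjAct W τ ((2 ^ k : ℕ) : ℤ) r) -
        galoisCohomology.localization ((W.baseChange K).torsionGaloisModule ((2 ^ k : ℕ) : ℤ))
          (Sum.inr v : Place K) 1 (s • r) := map_sub _ _ _
    have e2 : galoisCohomology.localization ((W.baseChange K).torsionGaloisModule ((2 ^ k : ℕ) : ℤ))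
        (Sum.inr v : Place K) 1 (s • r) = s • u := map_zsmul _ _ _
    have e3 : conjActPlace W τ ((2 ^ k : ℕ) : ℤ) hfix u = galoisCohomology.localization
        ((W.baseChange K).torsionGaloisModule ((2 ^ k : ℕ) : ℤ)) (Sum.inr v : Place K) 1 (conjAct W τ ((2 ^ k : ℕ) : ℤ) r) :=
      conjActPlace_localization W τ ((2 ^ k : ℕ) : ℤ) hfix r
    have h1 : w = conjActPlace W τ ((2 ^ k : ℕ) : ℤ) hfix u - s • u := by rw [e1, e2, e3]
    have hA : (2 ^ j) • conjActPlace W τ ((2 ^ k : ℕ) : ℤ) hfix u + (2 ^ j) • (s • u) = 0 := by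
      rw [← smul_add]
      exact hsign
    have h2 : (2 ^ j) • (s • u) + (2 ^ j) • (s • u) = s • ((2 ^ (j + 1)) • u) := by
      rw [← two_nsmul, ← mul_nsmul', ← pow_succ']
      exact smul_comm _ _ _
    have hq : (2 ^ j) • w + s • ((2 ^ (j + 1)) • u) = (2 ^ j) • conjActPlace W τ ((2 ^ k : ℕ) : ℤ) hfix u +
        (2 ^ j) • (s • u) := by
      rw [h1, nsmul_sub, ← h2]
      abel
    rw [hA] at hq
    have hdvd : addOrderOf ((2 ^ j) • w) ∣ addOrderOf w := addOrderOf_smul_dvd _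
    have h3 : addOrderOf u ∣ 2 ^ (j + 1) * addOrderOf ((2 ^ (j + 1)) • u) :=
      addOrderOf_dvd_of_nsmul_eq_zero (by rw [mul_nsmul, addOrderOf_nsmul_eq_zero])
    have h4 : addOrderOf ((2 ^ (j + 1)) • u) = addOrderOf ((2 ^ j) • w) := by
      have e := eq_neg_of_add_eq_zero_left hq
      rw [e, addOrderOf_neg]
      rcases hs with rfl | rfl
      · rw [one_zsmul]
      · rw [neg_one_zsmul, addOrderOf_neg]
    calc addOrderOf u ≤ 2 ^ (j + 1) * addOrderOf ((2 ^ (j + 1)) • u) :=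
          Nat.le_of_dvd (Nat.mul_pos (by positivity) (addOrderOf_pos _)) h3
      _ = 2 ^ (j + 1) * addOrderOf ((2 ^ j) • w) := by rw [h4]
      _ ≤ 2 ^ (j + 1) * addOrderOf w := Nat.mul_le_mul_left _ (Nat.le_of_dvd (addOrderOf_pos _) hdvd)

end Summit.BirchSwinnertonDyer.BirchSwinnertonDyer.Theorems.KolyvaginAtTwo.RegularRefill

end
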